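import Summits.CriticalPhenomena.CardyFormulaZ2.Theses.CardyIKTransport

/-!
# Route `CardyIKTransport`, assembly item `Assembly` (stmt-CriticalPhenomena-4971) — proved

The assembly declaration
`Summit.CriticalPhenomena.CardyFormulaZ2.Theses.CardyIKTransport.Assembly` is the implication

  AnchorByRigidity → Smirnov (site-`𝕋` Cardy, `hasCrossingLimit_triDomainCrossingProb`) →
  RenewalGridHarmless → CrudeToCanonical →
  ∀ P K, (a) quarter-turn invariance of the limits of `P` →
         (b) `P` has the limits of site-`𝕋` crossing probabilities on `R.map K` →
         (c) (Cardy for `P` in every conformal rectangle → Cardy for bond-`ℤ²` at `p = 1/2`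
              drawn on some asymptotically homogeneous isotropic product grid `{s i} × {t j}`) →
  CardyFormulaZ2.

It is pure logic over its named hypotheses: `AnchorByRigidity` applied to Smirnov, `P`, `K`,
(a), (b) gives Cardy limits for `P` in every conformal rectangle; (c) turns that into Cardy for the
crude embedded bond-`ℤ²` crossing event on a product grid `{s i} × {t j}` with `s i / i → a`,
`t j / j → a`; `RenewalGridHarmless` moves it to the standard embedding
`squareLatticeEmbedding.z`; `CrudeToCanonical` upgrades the crude event to G02's
`bondDomainCrossingProb`, whose Cardy limit in every conformal rectangle is, by definition,
`CardyFormulaZ2` (`Literature.Probability.Percolation.CardyFormulaZ2`).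

No analytic or probabilistic content is used; the mathematics of the route lives in the
hypotheses (items `AnchorByRigidity` 4969 — proved, `RenewalGridHarmless` 4967,
`CrudeToCanonical` 4968, and the cruxes feeding (b), (c)).
-/

namespace Summit.CriticalPhenomena.CardyFormulaZ2.Theorems

/-- The assembly item `Assembly` of route `CardyIKTransport` (stmt-CriticalPhenomena-4971):
from `AnchorByRigidity`, Smirnov's theorem, `RenewalGridHarmless` and `CrudeToCanonical`, any
family `P` of crossing functions that is quarter-turn invariant in the limit, linearly conjugate
(via `K`) to site-`𝕋` crossing probabilities, and whose Cardy limits transfer to bond-`ℤ²` on a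
homogeneous isotropic product grid, yields Cardy's formula for bond percolation on `ℤ²` at
`p = 1/2`. Proof: composition of the hypotheses (pure logic). -/
theorem cardyIKTransport_assembly_proof :
    Summit.CriticalPhenomena.CardyFormulaZ2.Theses.CardyIKTransport.Assembly := by
  unfold Summit.CriticalPhenomena.CardyFormulaZ2.Theses.CardyIKTransport.Assembly
  intro hAnchor hSmirnov hGrid hCrude P K hqt hK hTransfer
  -- Cardy limits for `P` in every conformal rectangle (two-ended rigidity + Smirnov).
  have hP := (hAnchor hSmirnov P K hqt hK).2
  -- Transfer to bond-ℤ² on a homogeneous isotropic product grid.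
  obtain ⟨a, s, t, ha, hs, ht, hsa, hta, hR⟩ := hTransfer hP
  -- Product grid → standard embedding → canonical (G02) crossing event = CardyFormulaZ2.
  exact hCrude (hGrid a s t ha hs ht hsa hta hR)

end Summit.CriticalPhenomena.CardyFormulaZ2.Theorems
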